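import Mathlib.MeasureTheory.Integral.IntegralEqImproper
import Literature.NumberTheory.LFunctions.RieszCriterionProofs
import HarnessLib

/-!
# RH-EQUIVALENT (one half PROVED) · Hardy–Littlewood's criterion `HardyLittlewood1916_criterion`: the direction "`Σ_{k≥1} (−x)^k/(k! ζ(2k+1)) = O(x^{−1/4+δ})` for every `δ > 0` ⟹ RH" PROVED via the Mellin transform `Γ(z)/ζ(1−2z)` — nothing here bears on the truth of RH

Literature-typing tranche `rh-lit-broughan-2` (Broughan, *Equivalents of the Riemann Hypothesis*,
Vol. 2, Ch. 2 "Series Equivalents", §2.4 "The Series of Hardy and Littlewood" pp. 15–16). The typed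
named fact `HardyLittlewood1916_criterion` (file `RieszTypeSeriesCriteria`) reads
`RiemannHypothesis ↔ ∀ δ > 0, H = O(x^{−1/4+δ})` at `+∞`, `H(x) = Σ_{k≥1} (−x)^k/(k! ζ(2k+1))`
(`hardyLittlewoodFunction`). This file PROVES the direction "⟸" (sufficiency), along the lines of
the sibling file `RieszCriterionProofs` (Titchmarsh §14.32 treats Riesz's function and says "a
similar condition stated by Hardy and Littlewood is (14.32.3)"); the direction "⟹" stays the
content of the fact.

## The argument

* §1 `hardyLittlewoodFunction_eq_tsum_moebius` — `H(x) = Σ_{n≥1} (μ(n)/n)(e^{−x/n²} − 1)`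
  (insert `1/ζ(2k+1) = Σ μ(n) n^{−2k−1}`, interchange the absolutely convergent double series).
* §2 `integral_exp_neg_sub_one_mul_cpow` — the Cauchy–Saalschütz integral
  `∫₀^∞ (e^{−u} − 1) u^{z−1} du = Γ(z)` for `−1 < Re z < 0` (integration by parts from Euler's
  integral); `integral_cpow_mul_hlKernel` — `∫₀^∞ t^{z−1}(e^{−t/n²} − 1) dt = n^{2z} Γ(z)`;
  `mellin_hardyLittlewoodFunction_mul_riemannZeta` — `(∫₀^∞ H(t) t^{z−1} dt)·ζ(1−2z) = Γ(z)` for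
  `−1 < Re z < 0` (termwise integration, dominated by `Σ n^{2Re z−1}|Γ(Re z)|`).
* §3 continuity of `H`, `|H(x)| ≤ |x| e^{|x|}`, and holomorphy of the Mellin transform on
  `−1 < Re z < 1/4 − δ` under `H = O(x^{−1/4+δ})`.
* §4 `riemannHypothesis_of_hardyLittlewoodFunction_isBigO` — identity theorem on the punctured
  strip `{−1 < Re z < 1/4−δ} ∖ {0}` (pole of `ζ(1−2z)` and of `Γ` at `z = 0`); a zero `ρ` with
  `1/2 < Re ρ < 1` (take `z = (1−ρ)/2`) would force `Γ((1−ρ)/2) = 0`;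
  `HardyLittlewood1916_criterion.mpr_holds`.

No new definitions, no new facts (D-0026); standard axioms only.

## References

* [HardyLittlewood1916] G. H. Hardy, J. E. Littlewood, *Contributions to the theory of the Riemann
  zeta-function and the theory of the distribution of primes*, Acta Math. 41 (1916/1918), §2.5
  (2.545).
* [Titchmarsh1986] E. C. Titchmarsh, *The Theory of the Riemann Zeta-Function*, 2nd ed., §14.32
  (14.32.3) [corpus: book:titchmarsh1986 p. 280].
* [Broughan2017] K. Broughan, *Equivalents of the Riemann Hypothesis*, Vol. 2, §2.4 (secondary).
-/

noncomputable section

open MeasureTheory Set Filter Asymptotics Complex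
open scoped Real Topology Nat

namespace Literature.NumberTheory.LFunctions

/-! ## §1 `H(x) = Σ_{n≥1} (μ(n)/n)(e^{−x/n²} − 1)` -/

/-- The inner sum: `Σ_{k≥0} (−x)^{k+1}/((k+1)! n^{2k+3}) = (1/n)(e^{−x/n²} − 1)` (`n ≥ 1`).
[cite: Titchmarsh1986, §14.32 (14.32.3) (the Hardy–Littlewood series)] -/
theorem hasSum_hlTerm_inner (x : ℝ) {n : ℕ} (hn : n ≠ 0) :
    HasSum (fun k : ℕ ↦ (-(x : ℂ)) ^ (k + 1) / ((k + 1)! : ℂ) / (n : ℂ) ^ (2 * k + 3))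
      ((((Real.exp (-(x / (n : ℝ) ^ 2)) - 1) / n : ℝ) : ℂ)) := by
  have hn' : (n : ℂ) ≠ 0 := Nat.cast_ne_zero.2 hn
  set y : ℂ := -((x : ℂ) / (n : ℂ) ^ 2) with hy
  have h0 := NormedSpace.expSeries_div_hasSum_exp y
  rw [← congrFun Complex.exp_eq_exp_ℂ y] at h0
  have h1 := (hasSum_nat_add_iff' (f := fun k : ℕ ↦ y ^ k / (k ! : ℂ)) 1).2 h0
  simp only [Finset.sum_range_one, pow_zero, Nat.factorial_zero, Nat.cast_one, div_one] at h1
  have h2 := h1.mul_left ((n : ℂ)⁻¹)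
  have hval : (n : ℂ)⁻¹ * (cexp y - 1) = ((((Real.exp (-(x / (n : ℝ) ^ 2)) - 1) / n : ℝ) : ℂ)) := by
    rw [hy]
    push_cast
    ring
  rw [← hval]
  refine h2.congr_fun fun k ↦ ?_
  rw [hy, neg_pow (x : ℂ), neg_pow ((x : ℂ) / (n : ℂ) ^ 2), div_pow, ← pow_mul]
  field_simp
  ring

/-- **The Hardy–Littlewood function as a Möbius series:**
`Σ_{k≥1} (−x)^k/(k! ζ(2k+1)) = Σ_{n≥1} (μ(n)/n)(e^{−x/n²} − 1)` for every real `x`.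
[cite: Titchmarsh1986, §14.32 (14.32.3); HardyLittlewood1916, §2.5] -/
theorem hardyLittlewoodFunction_eq_tsum_moebius (x : ℝ) :
    (hardyLittlewoodFunction x : ℂ) =
      ∑' n : ℕ, ((ArithmeticFunction.moebius n : ℤ) : ℂ) *
        ((((Real.exp (-(x / (n : ℝ) ^ 2)) - 1) / n : ℝ) : ℂ)) := by
  set μ' : ℕ → ℂ := fun n ↦ ((ArithmeticFunction.moebius n : ℤ) : ℂ) with hμ'
  set c : ℕ → ℂ := fun k ↦ (-(x : ℂ)) ^ (k + 1) / ((k + 1)! : ℂ) with hc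
  set w : ℕ → ℂ := fun k ↦ ((2 * (k : ℝ) + 3 : ℝ) : ℂ) with hw
  have hwre : ∀ k : ℕ, 1 < (w k).re := fun k ↦ by
    simp only [hw, ofReal_re]
    linarith [(Nat.cast_nonneg k : (0 : ℝ) ≤ k)]
  have hwnat : ∀ k : ℕ, w k = ((2 * k + 3 : ℕ) : ℂ) := fun k ↦ by
    simp only [hw]
    push_cast
    ring
  -- (a) cast the defining series
  have hA : (hardyLittlewoodFunction x : ℂ) = ∑' k : ℕ, c k * (riemannZeta (w k))⁻¹ := by
    rw [hardyLittlewoodFunction, ofReal_tsum]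
    refine tsum_congr fun k ↦ ?_
    simp only [ofReal_div, ofReal_mul, ofReal_pow, ofReal_neg, ofReal_natCast]
    rw [← riemannZeta_ofReal_eq_re, div_mul_eq_div_div, div_eq_mul_inv]
  -- (b) expand `1/ζ(2k+3)`
  have hB : ∀ k : ℕ, c k * (riemannZeta (w k))⁻¹ = ∑' n : ℕ, c k * LSeries.term μ' (w k) n :=
    fun k ↦ by rw [← (hasSum_moebius_term_inv_riemannZeta (hwre k)).tsum_eq, tsum_mul_left]
  -- (c) absolute summability of the double family
  have hk_summ : Summable fun k : ℕ ↦ |x| ^ (k + 1) / (k + 1)! :=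
    (summable_nat_add_iff 1).2 (Real.summable_pow_div_factorial |x|)
  have hn_summ : Summable fun n : ℕ ↦ 1 / (n : ℝ) ^ 2 := Real.summable_one_div_nat_pow.2 one_lt_two
  have hsumm : Summable (Function.uncurry fun k n ↦ c k * LSeries.term μ' (w k) n) := by
    refine Summable.of_norm_bounded (hk_summ.mul_of_nonneg hn_summ (fun k ↦ by positivity)
      (fun n ↦ by positivity)) ?_
    rintro ⟨k, n⟩
    simp only [Function.uncurry_apply_pair]
    rcases eq_or_ne n 0 with rfl | hn
    · simp
    have hck : ‖c k‖ = |x| ^ (k + 1) / (k + 1)! := by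
      simp only [hc, norm_div, norm_pow, norm_neg, Complex.norm_real, Real.norm_eq_abs,
        Complex.norm_natCast]
    have hμn : ‖μ' n‖ ≤ 1 := by
      simp only [hμ', Complex.norm_intCast]
      exact_mod_cast ArithmeticFunction.abs_moebius_le_one
    have hpow : (n : ℝ) ^ 2 ≤ ‖(n : ℂ) ^ (w k)‖ := by
      rw [hwnat, cpow_natCast, norm_pow, Complex.norm_natCast]
      exact pow_le_pow_right₀ (by exact_mod_cast Nat.one_le_iff_ne_zero.2 hn) (by omega)
    rw [LSeries.term_of_ne_zero hn, norm_mul, hck, norm_div]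
    gcongr
  -- (d) the inner sums
  have hD : ∀ n : ℕ, ∑' k : ℕ, c k * LSeries.term μ' (w k) n =
      μ' n * ((((Real.exp (-(x / (n : ℝ) ^ 2)) - 1) / n : ℝ) : ℂ)) := fun n ↦ by
    rcases eq_or_ne n 0 with rfl | hn
    · simp [hμ']
    rw [← ((hasSum_hlTerm_inner x hn).mul_left (μ' n)).tsum_eq]
    refine tsum_congr fun k ↦ ?_
    rw [LSeries.term_of_ne_zero hn, hwnat, cpow_natCast]
    simp only [hc]
    ring
  calc (hardyLittlewoodFunction x : ℂ)
      = ∑' k : ℕ, ∑' n : ℕ, c k * LSeries.term μ' (w k) n := by rw [hA]; exact tsum_congr hB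
    _ = ∑' n : ℕ, ∑' k : ℕ, c k * LSeries.term μ' (w k) n := hsumm.tsum_comm.symm
    _ = _ := tsum_congr hD

/-! ## §2 The Cauchy–Saalschütz integral and the Mellin transform of `H` -/

/-- `|e^{−x} − 1| = 1 − e^{−x} ≤ x` for `x ≥ 0`. [cite: Titchmarsh1986, §14.32 (elementary bound used for (14.32.3))] -/
theorem norm_exp_neg_sub_one_le {x : ℝ} (hx : 0 ≤ x) :
    ‖(((Real.exp (-x) - 1 : ℝ)) : ℂ)‖ ≤ x := by
  rw [Complex.norm_real, Real.norm_eq_abs, abs_sub_comm, abs_of_nonneg (by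
    have := Real.exp_le_one_iff.2 (neg_nonpos.2 hx); linarith)]
  linarith [Real.add_one_le_exp (-x)]

/-- `|e^{−x} − 1| ≤ 1` for `x ≥ 0`. [cite: Titchmarsh1986, §14.32 (elementary bound used for (14.32.3))] -/
theorem norm_exp_neg_sub_one_le_one {x : ℝ} (hx : 0 ≤ x) :
    ‖(((Real.exp (-x) - 1 : ℝ)) : ℂ)‖ ≤ 1 := by
  rw [Complex.norm_real, Real.norm_eq_abs, abs_sub_comm, abs_of_nonneg (by
    have := Real.exp_le_one_iff.2 (neg_nonpos.2 hx); linarith)]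
  linarith [Real.exp_pos (-x)]

/-- The Mellin integral of `e^{−x} − 1` converges absolutely for `−1 < Re z < 0`.
[cite: Titchmarsh1986, §14.32 (convergence of the Mellin integral for (14.32.3))] -/
theorem mellinConvergent_exp_neg_sub_one {z : ℂ} (hz1 : -1 < z.re) (hz2 : z.re < 0) :
    MellinConvergent (fun x : ℝ ↦ (((Real.exp (-x) - 1 : ℝ)) : ℂ)) z := by
  have hcont : Continuous fun x : ℝ ↦ (((Real.exp (-x) - 1 : ℝ)) : ℂ) := by fun_prop
  refine mellinConvergent_of_isBigO_rpow (a := 0) (b := -1)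
    (hcont.locallyIntegrable.locallyIntegrableOn _) ?_ hz2 ?_ hz1
  · refine IsBigO.of_bound 1 ?_
    filter_upwards [eventually_ge_atTop (0 : ℝ)] with x hx
    rw [neg_zero, Real.rpow_zero, norm_one, mul_one]
    exact norm_exp_neg_sub_one_le_one hx
  · refine IsBigO.of_bound 1 ?_
    filter_upwards [self_mem_nhdsWithin] with x (hx : 0 < x)
    rw [neg_neg, Real.rpow_one, Real.norm_of_nonneg hx.le, one_mul]
    exact norm_exp_neg_sub_one_le hx.le

/-- **Cauchy–Saalschütz:** `∫₀^∞ (e^{−u} − 1) u^{z−1} du = Γ(z)` for `−1 < Re z < 0` (integration by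
parts from Euler's integral: the boundary terms `(e^{−u}−1)u^z/z` vanish at `0` and `∞`).
[cite: Titchmarsh1986, §14.32 (Mellin transform behind (14.32.3))] -/
theorem integral_cpow_mul_exp_neg_sub_one {z : ℂ} (hz1 : -1 < z.re) (hz2 : z.re < 0) :
    ∫ u in Ioi (0 : ℝ), (u : ℂ) ^ (z - 1) * (((Real.exp (-u) - 1 : ℝ)) : ℂ) = Gamma z := by
  have hz0 : z ≠ 0 := fun h ↦ by rw [h, zero_re] at hz2; exact lt_irrefl _ hz2
  have hzm1 : z - 1 ≠ -1 := fun h ↦ hz0 (by linear_combination h)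
  have hzp : 0 < (z + 1).re := by simp only [add_re, one_re]; linarith
  -- the parts
  set U : ℝ → ℂ := fun x ↦ (((Real.exp (-x) - 1 : ℝ)) : ℂ) with hU
  set U' : ℝ → ℂ := fun x ↦ (((-Real.exp (-x) : ℝ)) : ℂ) with hU'
  set V : ℝ → ℂ := fun x ↦ (x : ℂ) ^ (z - 1 + 1) / (z - 1 + 1) with hV
  set V' : ℝ → ℂ := fun x ↦ (x : ℂ) ^ (z - 1) with hV'
  have hu : ∀ x ∈ Ioi (0 : ℝ), HasDerivAt U (U' x) x := fun x _ ↦ by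
    have h := (((hasDerivAt_neg x).exp).sub_const 1).ofReal_comp
    rw [show Real.exp (-x) * -1 = -Real.exp (-x) by ring] at h
    exact h
  have hv : ∀ x ∈ Ioi (0 : ℝ), HasDerivAt V (V' x) x := fun x (hx : 0 < x) ↦
    hasDerivAt_ofReal_cpow_const' hx.ne' hzm1
  -- integrability of `U V'` and `U' V`
  have huv' : IntegrableOn (U * V') (Ioi 0) := by
    refine (mellinConvergent_exp_neg_sub_one hz1 hz2).congr_fun (fun x _ ↦ ?_) measurableSet_Ioi
    simp only [hU, hV', Pi.mul_apply, smul_eq_mul, mul_comm]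
  have hu'v_eq : ∀ x ∈ Ioi (0 : ℝ), U' x * V x =
      -(1 / z) * (((Real.exp (-x) : ℝ) : ℂ) * (x : ℂ) ^ (z + 1 - 1)) := fun x _ ↦ by
    simp only [hU', hV, sub_add_cancel, add_sub_cancel_right]
    push_cast
    ring
  have hu'v : IntegrableOn (U' * V) (Ioi 0) := by
    have h : IntegrableOn (fun x : ℝ ↦ -(1 / z) * (((Real.exp (-x) : ℝ) : ℂ) * (x : ℂ) ^ (z + 1 - 1)))
        (Ioi 0) := (Complex.GammaIntegral_convergent hzp).const_mul (-(1 / z))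
    exact h.congr_fun (fun x hx ↦ (hu'v_eq x hx).symm) measurableSet_Ioi
  -- boundary behaviour
  have hnormV : ∀ x : ℝ, 0 < x → ‖V x‖ = x ^ z.re / ‖z‖ := fun x hx ↦ by
    simp only [hV, sub_add_cancel, norm_div, norm_cpow_eq_rpow_re_of_pos hx]
  have h_zero : Tendsto (U * V) (𝓝[>] 0) (𝓝 0) := by
    refine squeeze_zero_norm' (a := fun x : ℝ ↦ x ^ (z.re + 1) / ‖z‖) ?_ ?_
    · filter_upwards [self_mem_nhdsWithin] with x (hx : 0 < x)
      rw [Pi.mul_apply, norm_mul, hnormV x hx, Real.rpow_add_one hx.ne', ← mul_div_assoc,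
        mul_comm (x ^ z.re) x]
      gcongr
      exact norm_exp_neg_sub_one_le hx.le
    · have h : Tendsto (fun x : ℝ ↦ x ^ (z.re + 1) / ‖z‖) (𝓝[>] 0) (𝓝 (0 ^ (z.re + 1) / ‖z‖)) :=
        ((Real.continuousAt_rpow_const 0 (z.re + 1) (Or.inr (by linarith))).tendsto.mono_left
          nhdsWithin_le_nhds).div_const ‖z‖
      rwa [Real.zero_rpow (by linarith), zero_div] at h
  have h_infty : Tendsto (U * V) atTop (𝓝 0) := by
    refine squeeze_zero_norm' (a := fun x : ℝ ↦ x ^ (-(-z.re)) / ‖z‖) ?_ ?_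
    · filter_upwards [eventually_gt_atTop (0 : ℝ)] with x hx
      rw [Pi.mul_apply, norm_mul, hnormV x hx, neg_neg, ← mul_div_assoc]
      exact div_le_div_of_nonneg_right (mul_le_of_le_one_left (Real.rpow_nonneg hx.le _)
        (norm_exp_neg_sub_one_le_one hx.le)) (norm_nonneg _)
    · simpa using (tendsto_rpow_neg_atTop (by linarith : 0 < -z.re)).div_const ‖z‖
  -- integrate by parts
  have hparts := integral_Ioi_mul_deriv_eq_deriv_mul hu hv huv' hu'v h_zero h_infty
  have hlhs : ∫ u in Ioi (0 : ℝ), (u : ℂ) ^ (z - 1) * (((Real.exp (-u) - 1 : ℝ)) : ℂ) =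
      ∫ u in Ioi (0 : ℝ), U u * V' u :=
    setIntegral_congr_fun measurableSet_Ioi fun u _ ↦ by simp only [hU, hV', mul_comm]
  rw [hlhs, hparts, setIntegral_congr_fun measurableSet_Ioi hu'v_eq, integral_const_mul,
    ← GammaIntegral, ← Gamma_eq_integral hzp, Gamma_add_one z hz0]
  field_simp
  ring

/-- Mellin transform of one kernel: `∫₀^∞ t^{z−1} (e^{−t/n²} − 1) dt = n^{2z} Γ(z)` for `n ≥ 1`,
`−1 < Re z < 0`. [cite: Titchmarsh1986, §14.32 (termwise Mellin transform behind (14.32.3))] -/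
theorem integral_cpow_mul_hlKernel {n : ℕ} (hn : n ≠ 0) {z : ℂ} (hz1 : -1 < z.re) (hz2 : z.re < 0) :
    ∫ t in Ioi (0 : ℝ), (t : ℂ) ^ (z - 1) * (((Real.exp (-(t / (n : ℝ) ^ 2)) - 1 : ℝ)) : ℂ) =
      (n : ℂ) ^ (2 * z) * Gamma z := by
  have hG : mellin (fun u : ℝ ↦ (((Real.exp (-u) - 1 : ℝ)) : ℂ)) z = Gamma z := by
    rw [mellin, ← integral_cpow_mul_exp_neg_sub_one hz1 hz2]
    refine setIntegral_congr_fun measurableSet_Ioi fun t _ ↦ ?_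
    rw [smul_eq_mul]
  have hpow : (((1 / (n : ℝ) ^ 2 : ℝ)) : ℂ) ^ (-z) = (n : ℂ) ^ (2 * z) := by
    rw [cpow_def_of_ne_zero (ofReal_ne_zero.2 (by positivity)),
      cpow_def_of_ne_zero (Nat.cast_ne_zero.2 hn), ← ofReal_log (by positivity), one_div,
      Real.log_inv, Real.log_pow, ← Complex.natCast_log]
    congr 1
    push_cast
    ring
  have hscale := mellin_comp_mul_left (fun u : ℝ ↦ (((Real.exp (-u) - 1 : ℝ)) : ℂ)) z
    (a := 1 / (n : ℝ) ^ 2) (by positivity)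
  rw [hG, hpow, smul_eq_mul] at hscale
  rw [← hscale, mellin]
  refine setIntegral_congr_fun measurableSet_Ioi fun t _ ↦ ?_
  rw [smul_eq_mul, one_div, inv_mul_eq_div]

/-- **The Mellin transform of the Hardy–Littlewood function** (`−1 < Re z < 0`):
`(∫₀^∞ H(t) t^{z−1} dt) · ζ(1−2z) = Γ(z)` (termwise integration of the Möbius series;
`Σ μ(n) n^{2z−1} = 1/ζ(1−2z)`). [cite: Titchmarsh1986, §14.32 (14.32.3); HardyLittlewood1916, §2.5] -/
theorem mellin_hardyLittlewoodFunction_mul_riemannZeta {z : ℂ} (hz1 : -1 < z.re) (hz2 : z.re < 0) :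
    mellin (fun t : ℝ ↦ (hardyLittlewoodFunction t : ℂ)) z * riemannZeta (1 - 2 * z) = Gamma z := by
  set μ' : ℕ → ℂ := fun n ↦ ((ArithmeticFunction.moebius n : ℤ) : ℂ) with hμ'
  have hw : 1 < (1 - 2 * z).re := by
    simp only [sub_re, one_re, mul_re, re_ofNat, im_ofNat, zero_mul, sub_zero]
    linarith
  have hz0 : z ≠ 0 := fun h ↦ by rw [h, zero_re] at hz2; exact lt_irrefl _ hz2
  have hΓ : Gamma z ≠ 0 := by
    refine Gamma_ne_zero fun m hm ↦ ?_
    rcases Nat.eq_zero_or_pos m with rfl | hm0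
    · exact hz0 (by simpa using hm)
    · have := congrArg re hm
      simp only [neg_re, natCast_re] at this
      have : (1 : ℝ) ≤ m := by exact_mod_cast hm0
      linarith
  -- the summands
  set T : ℕ → ℝ → ℂ := fun n t ↦ μ' n * ((t : ℂ) ^ (z - 1) *
    ((((Real.exp (-(t / (n : ℝ) ^ 2)) - 1) / n : ℝ) : ℂ))) with hT
  have hT0 : T 0 = 0 := by funext t; simp [hT, hμ']
  have hTn : ∀ {n : ℕ}, n ≠ 0 → ∀ t : ℝ, T n t = (μ' n / n) * ((t : ℂ) ^ (z - 1) *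
      (((Real.exp (-(t / (n : ℝ) ^ 2)) - 1 : ℝ)) : ℂ)) := fun {n} hn t ↦ by
    have hn' : (n : ℂ) ≠ 0 := Nat.cast_ne_zero.2 hn
    simp only [hT]
    push_cast
    field_simp
  have hF : ∀ t ∈ Ioi (0 : ℝ), (t : ℂ) ^ (z - 1) • (hardyLittlewoodFunction t : ℂ) =
      ∑' n : ℕ, T n t := by
    intro t _
    rw [smul_eq_mul, hardyLittlewoodFunction_eq_tsum_moebius, ← tsum_mul_left]
    refine tsum_congr fun n ↦ ?_
    simp only [hT]
    ring
  have hTint : ∀ n : ℕ, ∫ t in Ioi (0 : ℝ), T n t = μ' n / n * ((n : ℂ) ^ (2 * z) * Gamma z) := by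
    intro n
    rcases eq_or_ne n 0 with rfl | hn
    · simp [hT0, hμ']
    · simp_rw [hTn hn]
      rw [integral_const_mul, integral_cpow_mul_hlKernel hn hz1 hz2]
  have hint : ∀ n : ℕ, Integrable (T n) (volume.restrict (Ioi (0 : ℝ))) := by
    intro n
    rcases eq_or_ne n 0 with rfl | hn
    · rw [hT0]; exact integrable_zero _ _ _
    · have h : Integrable (fun t : ℝ ↦ (μ' n / n) * ((t : ℂ) ^ (z - 1) *
          (((Real.exp (-(t / (n : ℝ) ^ 2)) - 1 : ℝ)) : ℂ))) (volume.restrict (Ioi (0 : ℝ))) := by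
        refine Integrable.const_mul (Integrable.of_integral_ne_zero ?_) _
        rw [integral_cpow_mul_hlKernel hn hz1 hz2]
        refine mul_ne_zero ?_ hΓ
        rw [Ne, cpow_eq_zero_iff, not_and_or]
        exact Or.inl (Nat.cast_ne_zero.2 hn)
      exact h.congr (ae_of_all _ fun t ↦ (hTn hn t).symm)
  -- norms: `∫ ‖T n‖ = (|μ(n)|/n) · n^{2 Re z} · |Γ(Re z)|`, summable since `2 Re z - 1 < -1`
  have hreal : ∀ {n : ℕ}, n ≠ 0 → ∫ t in Ioi (0 : ℝ), t ^ (z.re - 1) *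
      (Real.exp (-(t / (n : ℝ) ^ 2)) - 1) = (n : ℝ) ^ (2 * z.re) * Real.Gamma z.re := by
    intro n hn
    have hc := integral_cpow_mul_hlKernel hn (z := (z.re : ℂ)) (by simpa using hz1)
      (by simpa using hz2)
    have hlhs : ∫ t in Ioi (0 : ℝ), ((t : ℂ) ^ ((z.re : ℂ) - 1) *
        (((Real.exp (-(t / (n : ℝ) ^ 2)) - 1 : ℝ)) : ℂ)) =
        ∫ t in Ioi (0 : ℝ), (((t ^ (z.re - 1) * (Real.exp (-(t / (n : ℝ) ^ 2)) - 1)) : ℝ) : ℂ) := by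
      refine setIntegral_congr_fun measurableSet_Ioi fun t (ht : 0 < t) ↦ ?_
      rw [show ((z.re : ℂ) - 1) = ((z.re - 1 : ℝ) : ℂ) by push_cast; ring,
        ← ofReal_cpow ht.le]
      push_cast
      ring
    rw [hlhs, integral_complex_ofReal, show (2 * (z.re : ℂ)) = ((2 * z.re : ℝ) : ℂ) by push_cast; ring,
      show ((n : ℂ)) = ((n : ℝ) : ℂ) by norm_cast, ← ofReal_cpow (Nat.cast_nonneg n),
      Complex.Gamma_ofReal, ← ofReal_mul] at hc
    exact_mod_cast hc
  have hnorm : ∀ n : ℕ, ∫ t in Ioi (0 : ℝ), ‖T n t‖ =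
      ‖μ' n‖ / n * ((n : ℝ) ^ (2 * z.re) * |Real.Gamma z.re|) := by
    intro n
    rcases eq_or_ne n 0 with rfl | hn
    · simp [hT0]
    have hn0 : (0 : ℝ) < n := Nat.cast_pos.2 (Nat.pos_of_ne_zero hn)
    have hpt : ∀ t ∈ Ioi (0 : ℝ), ‖T n t‖ =
        ‖μ' n‖ / n * (-(t ^ (z.re - 1) * (Real.exp (-(t / (n : ℝ) ^ 2)) - 1))) := by
      intro t ht
      have ht0 : (0 : ℝ) < t := ht
      have hle : Real.exp (-(t / (n : ℝ) ^ 2)) - 1 ≤ 0 := by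
        have := Real.exp_le_one_iff.2 (neg_nonpos.2 (by positivity : 0 ≤ t / (n : ℝ) ^ 2))
        linarith
      rw [hTn hn, norm_mul, norm_mul, norm_div, Complex.norm_natCast,
        norm_cpow_eq_rpow_re_of_pos ht0, sub_re, one_re, Complex.norm_real, Real.norm_eq_abs,
        abs_of_nonpos hle]
      ring
    rw [setIntegral_congr_fun measurableSet_Ioi hpt, integral_const_mul, integral_neg, hreal hn]
    have hΓneg : Real.Gamma z.re < 0 := by
      -- `Γ(σ) = Γ(σ+1)/σ` with `Γ(σ+1) > 0`, `σ < 0`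
      have h1 : Real.Gamma (z.re + 1) = z.re * Real.Gamma z.re :=
        Real.Gamma_add_one (by linarith : z.re ≠ 0)
      have h2 : 0 < Real.Gamma (z.re + 1) := Real.Gamma_pos_of_pos (by linarith)
      nlinarith
    rw [abs_of_neg hΓneg]
    ring
  have hsum : Summable fun n : ℕ ↦ ∫ t in Ioi (0 : ℝ), ‖T n t‖ := by
    refine Summable.of_nonneg_of_le (fun n ↦ integral_nonneg fun t ↦ norm_nonneg _)
      (fun n ↦ ?_) (((Real.summable_nat_rpow.2 (by linarith : 2 * z.re - 1 < -1)).mul_right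
        |Real.Gamma z.re|))
    rw [hnorm]
    rcases eq_or_ne n 0 with rfl | hn
    · simp [Real.zero_rpow (by linarith : 2 * z.re - 1 ≠ 0)]
    have hn0 : (0 : ℝ) < n := Nat.cast_pos.2 (Nat.pos_of_ne_zero hn)
    have hμn : ‖μ' n‖ ≤ 1 := by
      simp only [hμ', Complex.norm_intCast]
      exact_mod_cast ArithmeticFunction.abs_moebius_le_one
    rw [Real.rpow_sub_one hn0.ne', show ‖μ' n‖ / n * ((n : ℝ) ^ (2 * z.re) * |Real.Gamma z.re|) =
      ‖μ' n‖ * ((n : ℝ) ^ (2 * z.re) / n * |Real.Gamma z.re|) by ring]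
    exact mul_le_of_le_one_left (by positivity) hμn
  -- `Σ (μ(n)/n) n^{2z} = Σ μ(n) n^{-(1-2z)} = 1/ζ(1-2z)`
  have hL : HasSum (fun n : ℕ ↦ LSeries.term μ' (1 - 2 * z) n) (riemannZeta (1 - 2 * z))⁻¹ :=
    hasSum_moebius_term_inv_riemannZeta hw
  have hterm : ∀ n : ℕ, μ' n / n * ((n : ℂ) ^ (2 * z) * Gamma z) =
      Gamma z * LSeries.term μ' (1 - 2 * z) n := by
    intro n
    rcases eq_or_ne n 0 with rfl | hn
    · simp [hμ']
    · have hn' : (n : ℂ) ≠ 0 := Nat.cast_ne_zero.2 hn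
      have hnz : (n : ℂ) ^ (2 * z) ≠ 0 := by
        rw [Ne, cpow_eq_zero_iff, not_and_or]
        exact Or.inl hn'
      rw [LSeries.term_of_ne_zero hn, cpow_sub _ _ hn', cpow_one]
      field_simp
  -- assemble
  rw [mellin, setIntegral_congr_fun measurableSet_Ioi hF,
    ← integral_tsum_of_summable_integral_norm hint hsum]
  simp_rw [hTint, hterm]
  rw [tsum_mul_left, hL.tsum_eq, mul_assoc,
    inv_mul_cancel₀ (riemannZeta_ne_zero_of_one_lt_re hw), mul_one]

/-! ## §3 `H` is continuous and `O(x)` at `0`; growth `O(x^{−1/4+δ})` makes its Mellin transform holomorphic on `−1 < Re z < 1/4−δ` -/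

/-- `1 ≤ ζ(x)` for real `x > 1` (private mirror, as in `RieszCriterionProofs`).
[cite: Titchmarsh1986, §14.32 (ζ(2k+1) ≥ 1 in the majorant of (14.32.3))] -/
private theorem one_le_re_riemannZeta_real' {x : ℝ} (hx : 1 < x) : 1 ≤ (riemannZeta x).re := by
  have hx' : 1 < (x : ℂ).re := by simpa using hx
  have hsum : Summable fun n : ℕ ↦ 1 / ((n : ℂ) + 1) ^ (x : ℂ) := by
    have := (Complex.summable_one_div_nat_cpow (p := (x : ℂ))).2 hx'
    rw [← summable_nat_add_iff 1] at this
    simpa using this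
  have hterm : ∀ n : ℕ, (1 / ((n : ℂ) + 1) ^ (x : ℂ)) = ((((n : ℝ) + 1) ^ x)⁻¹ : ℝ) := by
    intro n
    have : ((n : ℂ) + 1) = (((n : ℝ) + 1 : ℝ) : ℂ) := by push_cast; ring
    rw [this, ← Complex.ofReal_cpow (by positivity), one_div, Complex.ofReal_inv]
  rw [zeta_eq_tsum_one_div_nat_add_one_cpow hx', Complex.re_tsum hsum]
  simp_rw [hterm, Complex.ofReal_re]
  have hsum' : Summable fun n : ℕ ↦ (((n : ℝ) + 1) ^ x)⁻¹ := by
    have := Complex.reCLM.summable hsum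
    refine this.congr fun n ↦ ?_
    simp only [Complex.reCLM_apply, hterm, Complex.ofReal_re]
  calc (1 : ℝ) = ((((0 : ℕ) : ℝ) + 1) ^ x)⁻¹ := by simp
    _ ≤ ∑' n : ℕ, (((n : ℝ) + 1) ^ x)⁻¹ := hsum'.le_tsum 0 (fun j _ ↦ by positivity)

/-- Majorant of the defining series on `|x| ≤ R`: `|(−x)^{k+1}/((k+1)! ζ(2k+3))| ≤ R^{k+1}/(k+1)!`.
[cite: Titchmarsh1986, §14.32 (majorant of (14.32.3))] -/
theorem norm_hlTerm_le {R x : ℝ} (hx : |x| ≤ R) (k : ℕ) :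
    ‖(-x) ^ (k + 1) / (((k + 1)! : ℝ) * (riemannZeta (2 * k + 3 : ℝ)).re)‖ ≤
      R ^ (k + 1) / (k + 1)! := by
  have hζ : 1 ≤ (riemannZeta (2 * k + 3 : ℝ)).re :=
    one_le_re_riemannZeta_real' (by have : (0 : ℝ) ≤ k := k.cast_nonneg; linarith)
  have hk : (0 : ℝ) < (k + 1)! := by positivity
  have hden : (0 : ℝ) < ((k + 1)! : ℝ) * (riemannZeta (2 * k + 3 : ℝ)).re :=
    mul_pos hk (lt_of_lt_of_le one_pos hζ)
  rw [Real.norm_eq_abs, abs_div, abs_pow, abs_neg, abs_of_pos hden]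
  calc |x| ^ (k + 1) / (((k + 1)! : ℝ) * (riemannZeta (2 * k + 3 : ℝ)).re)
      ≤ |x| ^ (k + 1) / ((k + 1)! : ℝ) :=
        div_le_div_of_nonneg_left (by positivity) hk (le_mul_of_one_le_right hk.le hζ)
    _ ≤ R ^ (k + 1) / (k + 1)! := by gcongr

/-- The Hardy–Littlewood function is continuous (an entire power series).
[cite: HardyLittlewood1916, §2.5 (2.541) (integral function)] -/
theorem continuous_hardyLittlewoodFunction : Continuous hardyLittlewoodFunction := by
  refine continuous_iff_continuousAt.2 fun x₀ ↦ ?_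
  have hR : Icc (-(|x₀| + 1)) (|x₀| + 1) ∈ 𝓝 x₀ :=
    Icc_mem_nhds (by linarith [neg_abs_le x₀]) (by linarith [le_abs_self x₀])
  refine ContinuousOn.continuousAt ?_ hR
  have hu : Summable fun k : ℕ ↦ (|x₀| + 1) ^ (k + 1) / (k + 1)! :=
    (summable_nat_add_iff 1).2 (Real.summable_pow_div_factorial (|x₀| + 1))
  unfold hardyLittlewoodFunction
  refine continuousOn_tsum (fun k ↦ ?_) hu fun k x hx ↦
    norm_hlTerm_le (abs_le.2 ⟨by linarith [hx.1], hx.2⟩) k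
  exact (by fun_prop : Continuous fun x : ℝ ↦
    (-x) ^ (k + 1) / (((k + 1)! : ℝ) * (riemannZeta (2 * k + 3 : ℝ)).re)).continuousOn

/-- `|H(x)| ≤ e^{|x|} − 1` (termwise majorant), in particular `H(x) = O(x)` at `0`.
[cite: Titchmarsh1986, §14.32 (majorant of (14.32.3))] -/
theorem norm_hardyLittlewoodFunction_le (x : ℝ) :
    ‖hardyLittlewoodFunction x‖ ≤ Real.exp |x| - 1 := by
  have hu : HasSum (fun k : ℕ ↦ |x| ^ (k + 1) / (k + 1)!) (Real.exp |x| - 1) := by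
    have h0 := NormedSpace.expSeries_div_hasSum_exp |x|
    rw [← congrFun Real.exp_eq_exp_ℝ |x|] at h0
    have h1 := (hasSum_nat_add_iff' (f := fun k : ℕ ↦ |x| ^ k / (k ! : ℝ)) 1).2 h0
    simpa using h1
  have hn : ∀ k : ℕ, ‖(-x) ^ (k + 1) / (((k + 1)! : ℝ) * (riemannZeta (2 * k + 3 : ℝ)).re)‖ ≤
      |x| ^ (k + 1) / (k + 1)! := fun k ↦ norm_hlTerm_le le_rfl k
  have hsn : Summable fun k : ℕ ↦
      ‖(-x) ^ (k + 1) / (((k + 1)! : ℝ) * (riemannZeta (2 * k + 3 : ℝ)).re)‖ :=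
    Summable.of_nonneg_of_le (fun k ↦ norm_nonneg _) hn hu.summable
  calc ‖hardyLittlewoodFunction x‖
      ≤ ∑' k : ℕ, ‖(-x) ^ (k + 1) / (((k + 1)! : ℝ) * (riemannZeta (2 * k + 3 : ℝ)).re)‖ :=
        norm_tsum_le_tsum_norm hsn
    _ ≤ ∑' k : ℕ, |x| ^ (k + 1) / (k + 1)! := Summable.tsum_le_tsum hn hsn hu.summable
    _ = Real.exp |x| - 1 := hu.tsum_eq

/-- **Growth ⟹ holomorphy:** if `H(x) = O(x^{−1/4+δ})` as `x → ∞`, then `z ↦ ∫₀^∞ H(t) t^{z−1} dt`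
is holomorphic on the strip `−1 < Re z < 1/4 − δ`.
[cite: Titchmarsh1986, §14.32 (analytic continuation argument, as for (14.32.2))] -/
theorem differentiableAt_mellin_hardyLittlewoodFunction {δ : ℝ}
    (hδ : hardyLittlewoodFunction =O[atTop] fun x : ℝ ↦ x ^ (-(1 / 4 : ℝ) + δ)) {z : ℂ}
    (hz1 : -1 < z.re) (hz2 : z.re < 1 / 4 - δ) :
    DifferentiableAt ℂ (mellin fun t : ℝ ↦ (hardyLittlewoodFunction t : ℂ)) z := by
  refine mellin_differentiableAt_of_isBigO_rpow (a := 1 / 4 - δ) (b := -1) ?_ ?_ hz2 ?_ hz1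
  · exact (continuous_ofReal.comp continuous_hardyLittlewoodFunction).locallyIntegrable
      |>.locallyIntegrableOn _
  · refine (Complex.isBigO_ofReal_left.2 hδ).congr_right fun x ↦ ?_
    congr 1
    ring
  · refine IsBigO.of_bound 2 ?_
    filter_upwards [Ioo_mem_nhdsGT (zero_lt_one' ℝ)] with x hx
    rw [Complex.norm_real, neg_neg, Real.rpow_one, Real.norm_of_nonneg hx.1.le]
    calc ‖hardyLittlewoodFunction x‖ ≤ Real.exp |x| - 1 := norm_hardyLittlewoodFunction_le x
      _ ≤ |Real.exp |x| - 1| := le_abs_self _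
      _ ≤ 2 * |(|x|)| := Real.abs_exp_sub_one_le (by rw [abs_abs, abs_of_pos hx.1]; exact hx.2.le)
      _ = 2 * x := by rw [abs_abs, abs_of_pos hx.1]

/-! ## §4 Hardy–Littlewood's criterion, direction "⟸" -/

/-- The punctured strip `{−1 < Re z < c} ∖ {0}` (`c > 0`) is preconnected.
[cite: Titchmarsh1986, §14.32 (analytic continuation argument)] -/
private theorem isPreconnected_strip_punctured_zero {c : ℝ} (hc : 0 < c) :
    IsPreconnected {z : ℂ | (-1 < z.re ∧ z.re < c) ∧ z ≠ 0} := by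
  have hA : IsPreconnected {z : ℂ | -1 < z.re ∧ z.re < 0} :=
    ((convex_halfSpace_re_gt (-1)).inter (convex_halfSpace_re_lt 0)).isPreconnected
  have hB : IsPreconnected {z : ℂ | 0 < z.re ∧ z.re < c} :=
    ((convex_halfSpace_re_gt 0).inter (convex_halfSpace_re_lt c)).isPreconnected
  have hCp : IsPreconnected {z : ℂ | (-1 < z.re ∧ z.re < c) ∧ 0 < z.im} :=
    (((convex_halfSpace_re_gt (-1)).inter (convex_halfSpace_re_lt c)).inter
      (convex_halfSpace_im_gt 0)).isPreconnected
  have hCm : IsPreconnected {z : ℂ | (-1 < z.re ∧ z.re < c) ∧ z.im < 0} :=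
    (((convex_halfSpace_re_gt (-1)).inter (convex_halfSpace_re_lt c)).inter
      (convex_halfSpace_im_lt 0)).isPreconnected
  have h1 : IsPreconnected ({z : ℂ | -1 < z.re ∧ z.re < 0} ∪
      {z : ℂ | (-1 < z.re ∧ z.re < c) ∧ 0 < z.im}) := by
    refine IsPreconnected.union (⟨-1 / 2, 1⟩ : ℂ) ?_ ?_ hA hCp
    · exact ⟨show (-1 : ℝ) < -1 / 2 by norm_num, show (-1 / 2 : ℝ) < 0 by norm_num⟩
    · exact ⟨⟨show (-1 : ℝ) < -1 / 2 by norm_num, show (-1 / 2 : ℝ) < c by linarith⟩,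
        show (0 : ℝ) < 1 by norm_num⟩
  have h2 : IsPreconnected (({z : ℂ | -1 < z.re ∧ z.re < 0} ∪
      {z : ℂ | (-1 < z.re ∧ z.re < c) ∧ 0 < z.im}) ∪
      {z : ℂ | (-1 < z.re ∧ z.re < c) ∧ z.im < 0}) := by
    refine IsPreconnected.union (⟨-1 / 2, -1⟩ : ℂ) ?_ ?_ h1 hCm
    · exact Or.inl ⟨show (-1 : ℝ) < -1 / 2 by norm_num, show (-1 / 2 : ℝ) < 0 by norm_num⟩
    · exact ⟨⟨show (-1 : ℝ) < -1 / 2 by norm_num, show (-1 / 2 : ℝ) < c by linarith⟩,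
        show (-1 : ℝ) < 0 by norm_num⟩
  have h3 : IsPreconnected ((({z : ℂ | -1 < z.re ∧ z.re < 0} ∪
      {z : ℂ | (-1 < z.re ∧ z.re < c) ∧ 0 < z.im}) ∪
      {z : ℂ | (-1 < z.re ∧ z.re < c) ∧ z.im < 0}) ∪
      {z : ℂ | 0 < z.re ∧ z.re < c}) := by
    refine IsPreconnected.union (⟨c / 2, 1⟩ : ℂ) ?_ ?_ h2 hB
    · exact Or.inl (Or.inr ⟨⟨show (-1 : ℝ) < c / 2 by linarith, show (c / 2 : ℝ) < c by linarith⟩,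
        show (0 : ℝ) < 1 by norm_num⟩)
    · exact ⟨show (0 : ℝ) < c / 2 by linarith, show (c / 2 : ℝ) < c by linarith⟩
  convert h3 using 1
  ext z
  simp only [mem_union, mem_setOf_eq]
  constructor
  · rintro ⟨⟨h1, h2⟩, hne⟩
    rcases lt_trichotomy z.im 0 with hlt | heq | hgt
    · exact Or.inl (Or.inr ⟨⟨h1, h2⟩, hlt⟩)
    · have hzre : z.re ≠ 0 := fun h ↦ hne (Complex.ext (by rw [h, zero_re]) (by rw [heq, zero_im]))
      rcases lt_or_gt_of_ne hzre with hl | hg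
      · exact Or.inl (Or.inl (Or.inl ⟨h1, hl⟩))
      · exact Or.inr ⟨hg, h2⟩
    · exact Or.inl (Or.inl (Or.inr ⟨⟨h1, h2⟩, hgt⟩))
  · rintro (((⟨h1, h2⟩ | ⟨⟨h1, h2⟩, h3⟩) | ⟨⟨h1, h2⟩, h3⟩) | ⟨h1, h2⟩)
    · exact ⟨⟨h1, by linarith⟩, fun h ↦ by rw [h, zero_re] at h2; linarith⟩
    · exact ⟨⟨h1, h2⟩, fun h ↦ by rw [h, zero_im] at h3; linarith⟩
    · exact ⟨⟨h1, h2⟩, fun h ↦ by rw [h, zero_im] at h3; linarith⟩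
    · exact ⟨⟨by linarith, h2⟩, fun h ↦ by rw [h, zero_re] at h1; linarith⟩

/-- **Hardy–Littlewood's criterion, direction "⟸" (PROVED):** if
`Σ_{k≥1} (−x)^k/(k! ζ(2k+1)) = O(x^{−1/4+δ})` as `x → +∞` for every `δ > 0`, then the Riemann
hypothesis holds. The Mellin transform `M(z) = ∫₀^∞ H(t) t^{z−1} dt` is holomorphic on
`−1 < Re z < 1/4 − δ` and `M(z) ζ(1−2z) = Γ(z)` on `−1 < Re z < 0`; by analytic continuation on the
punctured strip (the point `z = 0` carries the poles of `ζ(1−2z)` and `Γ(z)`) the identity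
persists, so a zero `ρ` of `ζ` with `1/2 < Re ρ < 1` (take `z = (1−ρ)/2`, `δ` small) would force
`Γ((1−ρ)/2) = 0` — impossible; a zero-free strip `1/2 < Re s < 1` is RH
(`quasiRiemannHypothesis_one_half_iff_holds`). This is the right-to-left half of the named fact
`HardyLittlewood1916_criterion`. [cite: HardyLittlewood1916, §2.5 eq. (2.545) p. 161 (sufficiency); Titchmarsh1986, §14.32 (14.32.3)] -/
theorem riemannHypothesis_of_hardyLittlewoodFunction_isBigO
    (h : ∀ δ : ℝ, 0 < δ →
      hardyLittlewoodFunction =O[atTop] fun x : ℝ ↦ x ^ (-(1 / 4 : ℝ) + δ)) :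
    RiemannHypothesis := by
  refine quasiRiemannHypothesis_one_half_iff_holds.1 fun ρ hζ hρ1 hρ2 ↦ ?_
  set z₀ : ℂ := (1 - ρ) / 2 with hz₀
  have hz₀re : z₀.re = (1 - ρ.re) / 2 := by simp [hz₀]
  set δ : ℝ := (1 / 4 - z₀.re) / 2 with hδ
  have hδpos : 0 < δ := by rw [hδ, hz₀re]; linarith
  set c : ℝ := 1 / 4 - δ with hc
  have hc0 : 0 < c := by rw [hc, hδ, hz₀re]; linarith
  have hz₀c : z₀.re < c := by rw [hc, hδ]; linarith
  have hz₀1 : -1 < z₀.re := by rw [hz₀re]; linarith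
  have hz₀pos : 0 < z₀.re := by rw [hz₀re]; linarith
  -- the domain of continuation
  have hUo : IsOpen {z : ℂ | (-1 < z.re ∧ z.re < c) ∧ z ≠ 0} :=
    ((isOpen_lt continuous_const continuous_re).inter
      (isOpen_lt continuous_re continuous_const)).inter isOpen_ne
  have hΦ : AnalyticOnNhd ℂ
      (fun z ↦ mellin (fun t : ℝ ↦ (hardyLittlewoodFunction t : ℂ)) z * riemannZeta (1 - 2 * z))
      {z : ℂ | (-1 < z.re ∧ z.re < c) ∧ z ≠ 0} := by
    refine DifferentiableOn.analyticOnNhd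
      (fun z hz ↦ DifferentiableAt.differentiableWithinAt ?_) hUo
    refine (differentiableAt_mellin_hardyLittlewoodFunction (h δ hδpos) hz.1.1
      (by rw [hc] at hz; exact hz.1.2)).mul ?_
    refine (differentiableAt_riemannZeta ?_).comp z
      ((differentiableAt_const _).sub ((differentiableAt_const _).mul differentiableAt_id))
    intro h'
    exact hz.2 (by linear_combination (-1 / 2 : ℂ) * h')
  have hΨ : AnalyticOnNhd ℂ (fun z ↦ Gamma z) {z : ℂ | (-1 < z.re ∧ z.re < c) ∧ z ≠ 0} := by
    refine DifferentiableOn.analyticOnNhd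
      (fun z hz ↦ DifferentiableAt.differentiableWithinAt ?_) hUo
    refine differentiableAt_Gamma _ fun m hm ↦ ?_
    rcases Nat.eq_zero_or_pos m with rfl | hm0
    · exact hz.2 (by simpa using hm)
    · have := congrArg re hm
      simp only [neg_re, natCast_re] at this
      have : (1 : ℝ) ≤ m := by exact_mod_cast hm0
      linarith [hz.1.1]
  -- they agree on `-1 < Re z < 0`, a neighbourhood of `-1/2`
  have hz₁ : (⟨-1 / 2, 0⟩ : ℂ) ∈ {z : ℂ | (-1 < z.re ∧ z.re < c) ∧ z ≠ 0} :=
    ⟨⟨show (-1 : ℝ) < -1 / 2 by norm_num, show (-1 / 2 : ℝ) < c by linarith⟩,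
      fun h0 ↦ by have := congrArg re h0; rw [zero_re] at this; norm_num at this⟩
  have heq : (fun z ↦ mellin (fun t : ℝ ↦ (hardyLittlewoodFunction t : ℂ)) z *
      riemannZeta (1 - 2 * z)) =ᶠ[𝓝 (⟨-1 / 2, 0⟩ : ℂ)] fun z ↦ Gamma z := by
    have hV : {z : ℂ | -1 < z.re ∧ z.re < 0} ∈ 𝓝 (⟨-1 / 2, 0⟩ : ℂ) :=
      ((isOpen_lt continuous_const continuous_re).inter
        (isOpen_lt continuous_re continuous_const)).mem_nhds
        ⟨show (-1 : ℝ) < -1 / 2 by norm_num, show (-1 / 2 : ℝ) < 0 by norm_num⟩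
    exact eventuallyEq_of_mem hV fun z hz ↦
      mellin_hardyLittlewoodFunction_mul_riemannZeta hz.1 hz.2
  have hEq := hΦ.eqOn_of_preconnected_of_eventuallyEq hΨ
    (isPreconnected_strip_punctured_zero hc0) hz₁ heq
  -- evaluate at `z₀`: `M(z₀) ζ(ρ) = Γ(z₀)` with `ζ(ρ) = 0`
  have hz₀U : z₀ ∈ {z : ℂ | (-1 < z.re ∧ z.re < c) ∧ z ≠ 0} :=
    ⟨⟨hz₀1, hz₀c⟩, fun h0 ↦ by
      have := congrArg re h0
      rw [zero_re] at this
      linarith⟩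
  have key := hEq hz₀U
  dsimp only at key
  have hρ : 1 - 2 * z₀ = ρ := by rw [hz₀]; ring
  rw [hρ, hζ, mul_zero] at key
  exact Gamma_ne_zero_of_re_pos hz₀pos key.symm

/-- The same in the shape of the named fact: the right-hand side of `HardyLittlewood1916_criterion`
implies its left-hand side. [cite: HardyLittlewood1916, §2.5 eq. (2.545) p. 161, sufficiency] -/
theorem HardyLittlewood1916_criterion.mpr_holds :
    (∀ δ : ℝ, 0 < δ → hardyLittlewoodFunction =O[atTop] fun x : ℝ ↦ x ^ (-(1 / 4 : ℝ) + δ)) →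
      RiemannHypothesis :=
  riemannHypothesis_of_hardyLittlewoodFunction_isBigO

end Literature.NumberTheory.LFunctions

end
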